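import Mathlib.Analysis.Convex.Mul
import Literature.Computability.Complexity.BonamiLevelK
import HarnessLib

/-!
# The Bonami lemma (even moments) on the `p`-biased cube

The tree's `Literature.Computability.Complexity.BonamiLevelK.bonami_even_moment` is Bonami's lemma for the UNIFORM cube:
`𝔼[g^{2r}] ≤ (2r−1)^{rd} 𝔼[g²]^r` for `g` of Fourier degree `≤ d`. This module proves the `p`-BIASED analogue
(O'Donnell 2014, Ch. 10: hypercontractivity of general product spaces; Thm. 10.21 gives `‖f‖_q ≤ (√(q−1)·λ^{1/q−1/2})^{deg f}‖f‖₂`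
for the `λ`-biased cube) in the even-moment form and in a finite-sum vocabulary: points of the cube are the subsets
`V ⊆ s` of a finite ground set `s`, the `p`-biased weight of `V` is `w_s(V) = Π_{i∈s} (p if i ∈ V, 1−p otherwise)`, and a
function of degree `≤ d` is a polynomial `P_c(V) = Σ_{T ⊆ s, |T| ≤ d} c_T · Π_{i∈T} (𝟙[i∈V] − p)` in the centred coordinates
(every function on the cube is such a polynomial; this parametrisation turns the degree hypothesis into a support condition on `c`).

* `biased_bonami_even_moment` — **for `0 < p < 1`, every `r ≥ 1` and every `c` vanishing on the subsets of `s` of size `> d`: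
  `Σ_{V ⊆ s} w_s(V) · P_c(V)^{2r} ≤ ((2r−1)·max(p,1−p)/min(p,1−p))^{rd} · (Σ_{V ⊆ s} w_s(V) · P_c(V)²)^r`**,
  i.e. `‖P_c‖_{L^{2r}(μ_p)} ≤ (√(2r−1)·√((1−λ)/λ))^d · ‖P_c‖_{L²(μ_p)}`, `λ = min(p,1−p)` (the weights sum to `1`, `sum_bweight`).
  At `p = 1/2` the constant is the uniform `(2r−1)^{rd}`. [cite: ODonnell2014, Thm. 10.21 (even q; general product spaces)]
* THE PROOF is O'Donnell's §9.1 induction on the coordinates, exactly as in the tree's uniform file, with ONE new step: along the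
  new coordinate `a`, `P_c = A + φ_a·E` with `φ_a = 𝟙[a∈V] − p ∈ {−p, 1−p}` of mean `0`, `deg A ≤ d`, `deg E ≤ d−1`
  (`cpoly_insert_of_not_mem` / `cpoly_insert_insert`), and the **biased two-point inequality**
  `(1−p)(A − pE)^{2r} + p(A + (1−p)E)^{2r} ≤ ((A+u)^{2r} + (A−u)^{2r})/2`, `u = max(p,1−p)·|E|` (`biased_two_point_le`):
  a mean-zero law supported in `[−u, u]` is dominated in convex order by the symmetric two-point law on `{±u}`
  (convexity of `t ↦ t^{2r}`, Mathlib's `Even.convexOn_pow`). The right-hand side is the UNIFORM two-point quantity, so the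
  tree's `two_point_expand` and `sum_choose_two_mul_le` (`Σ_i C(2r,2i)P^{r−i}Q^i ≤ (P + (2r−1)Q)^r`) finish the coordinate step
  with `Q` scaled by `max(p,1−p)² = (max(p,1−p)/min(p,1−p))·p(1−p)`; the mixed moments are controlled by the weighted AM–GM step
  (`wsum_pow_mul_pow_le`, the weighted form of the tree's `avg_pow_mul_pow_le`).
* `biased_bonami_even_moment_univ` — the same on the whole cube `{V ⊆ Fin n}` with the weight written `p^{|V|}(1−p)^{n−|V|}`.

Consumer (cell pnp-psdrank, summit PneNP, LIT-29 §2): Bonami-quality level inequalities on slices `C([n],t)` with `t/n` away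
from `1/2`, and on balanced multislices, are transferred from the `p`-biased cube at `p = t/n` (where the slice has polynomial,
not exponential, weight); the companion module `JohnsonHarmonicsBiased` identifies the Johnson harmonics `zeta q` with the
polynomials `P_q` of this file (`zeta q V = Σ_T q_T Π_{i∈T}(𝟙[i∈V] − p)` for harmonic `q`, every `p`). Everything is PROVED; no
facts, no instances/notation; standard axioms. Label: support / instrument (Boolean-function analysis).
WHAT THIS IS NOT: not the general-`q` (non-even) hypercontractive inequality, not a level-`d` inequality, nothing about matchings,
psd rank or P vs NP.

## References
* [ODonnell2014] R. O'Donnell, *Analysis of Boolean Functions*, CUP 2014: §9.1 (the Bonami lemma, induction on coordinates),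
  §8.4 (p-biased analysis), Ch. 10 and Thm. 10.21 (hypercontractivity for general product probability spaces).
* A. Bonami, *Étude des coefficients de Fourier des fonctions de `L^p(G)`*, Ann. Inst. Fourier 20 (1970) 335–402.

§6 (appended): **`biased_bonami_even_moment_vec`** — the same inequality for a product of DIFFERENTLY biased bits
(`bweightv`/`cmonov`/`cpolyv` with `p : ι → ℝ`): for `p_i ∈ (0,1)` with `max(p_i,1−p_i)/min(p_i,1−p_i) ≤ κ` on `s` (`κ ≥ 1`),
`Σ_V w_s(V) P_c(V)^{2r} ≤ ((2r−1)κ)^{rd} (Σ_V w_s(V) P_c(V)²)^r` — the product-space generality of [cite: ODonnell2014, Thm. 10.21]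
restricted to two-point coordinates; needed for transfer to PRODUCTS of slices with different `t_i/n_i` (LIT-29 §6 (T2)).
-/

noncomputable section

namespace Literature.Combinatorics.AssociationSchemes.BiasedBonami

open Finset
open Literature.Computability.Complexity.LowDegree (two_point_expand sum_choose_two_mul_le)

variable {ι : Type*} [DecidableEq ι]

/-! ### §1 Biased weights, centred monomials, polynomials; splitting off one coordinate -/

/-- The `p`-biased weight of the point `V` of the cube on the ground set `s`: `Π_{i∈s} (p if i ∈ V, 1−p otherwise)`
(`= p^{|V|}(1−p)^{|s|−|V|}` for `V ⊆ s`). [cite: ODonnell2014, §8.4 (the p-biased measure π_p^{⊗n})] -/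
def bweight (s : Finset ι) (p : ℝ) (V : Finset ι) : ℝ := ∏ i ∈ s, (if i ∈ V then p else 1 - p)

/-- The centred monomial `φ_T(V) = Π_{i∈T} (𝟙[i∈V] − p)`. [cite: ODonnell2014, §8.4 (the φ-basis, up to scaling)] -/
def cmono (p : ℝ) (T V : Finset ι) : ℝ := ∏ i ∈ T, ((if i ∈ V then (1 : ℝ) else 0) - p)

/-- The polynomial with coefficient vector `c` on the ground set `s`: `P_c(V) = Σ_{T ⊆ s} c_T φ_T(V)`.
[cite: ODonnell2014, §8.4 (biased Fourier expansion)] -/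
def cpoly (s : Finset ι) (p : ℝ) (c : Finset ι → ℝ) (V : Finset ι) : ℝ := ∑ T ∈ s.powerset, c T * cmono p T V

/-- `w_∅ ≡ 1` (empty product). [cite: ODonnell2014, §8.4 (π_p^{⊗n}, n = 0)] -/
theorem bweight_empty (p : ℝ) (V : Finset ι) : bweight ∅ p V = 1 := by
  unfold bweight; rw [prod_empty]

/-- Adding a coordinate `a ∉ s`: at a point `V ∌ a` the weight picks up the factor `1−p` (product structure of `π_p^{⊗n}`).
[cite: ODonnell2014, §8.4 (π_p^{⊗n})] -/
theorem bweight_insert_of_not_mem {s : Finset ι} {a : ι} (ha : a ∉ s) (p : ℝ) {V : Finset ι} (haV : a ∉ V) :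
    bweight (insert a s) p V = (1 - p) * bweight s p V := by
  unfold bweight; rw [prod_insert ha, if_neg haV]

/-- Adding a coordinate `a ∉ s`: at the point `insert a V` the weight picks up the factor `p` (product structure of `π_p^{⊗n}`).
[cite: ODonnell2014, §8.4 (π_p^{⊗n})] -/
theorem bweight_insert_insert {s : Finset ι} {a : ι} (ha : a ∉ s) (p : ℝ) (V : Finset ι) :
    bweight (insert a s) p (insert a V) = p * bweight s p V := by
  unfold bweight
  rw [prod_insert ha, if_pos (mem_insert_self a V)]
  congr 1
  refine prod_congr rfl fun i hi => ?_
  have hia : i ≠ a := fun h => ha (h ▸ hi)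
  simp [mem_insert, hia]

/-- The weights are nonnegative for `0 ≤ p ≤ 1`. [cite: ODonnell2014, §8.4 (π_p^{⊗n} is a probability measure)] -/
theorem bweight_nonneg (s : Finset ι) {p : ℝ} (hp0 : 0 ≤ p) (hp1 : p ≤ 1) (V : Finset ι) : 0 ≤ bweight s p V := by
  unfold bweight
  refine prod_nonneg fun i _ => ?_
  split_ifs
  · exact hp0
  · linarith

/-- The weights of the points `V ⊆ s` sum to `1`. [cite: ODonnell2014, §8.4 (π_p^{⊗n} is a probability measure)] -/
theorem sum_bweight (s : Finset ι) (p : ℝ) : ∑ V ∈ s.powerset, bweight s p V = 1 := by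
  induction s using Finset.induction_on with
  | empty => rw [powerset_empty, sum_singleton, bweight_empty]
  | @insert a s ha ih =>
    rw [sum_powerset_insert ha]
    have h1 : ∑ V ∈ s.powerset, bweight (insert a s) p V = (1 - p) * ∑ V ∈ s.powerset, bweight s p V := by
      rw [mul_sum]
      refine sum_congr rfl fun V hV => bweight_insert_of_not_mem ha p ?_
      exact fun haV => ha (mem_powerset.1 hV haV)
    have h2 : ∑ V ∈ s.powerset, bweight (insert a s) p (insert a V) = p * ∑ V ∈ s.powerset, bweight s p V := by
      rw [mul_sum]
      exact sum_congr rfl fun V _ => bweight_insert_insert ha p V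
    rw [h1, h2, ih]; ring

/-- A monomial not involving `a` does not see the coordinate `a`: `φ_T(insert a V) = φ_T(V)` for `a ∉ T`.
[cite: ODonnell2014, §8.4 (φ_T depends on the coordinates in T only)] -/
theorem cmono_insert_of_not_mem (p : ℝ) {a : ι} {T : Finset ι} (haT : a ∉ T) (V : Finset ι) :
    cmono p T (insert a V) = cmono p T V := by
  unfold cmono
  refine prod_congr rfl fun i hi => ?_
  have hia : i ≠ a := fun h => haT (h ▸ hi)
  simp [mem_insert, hia]

/-- A monomial involving `a`: `φ_{T+a}(V) = (𝟙[a∈V] − p)·φ_T(V)` for `a ∉ T` (the φ-basis is multiplicative).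
[cite: ODonnell2014, §8.4 (φ_S = Π_{i∈S} φ(x_i))] -/
theorem cmono_insert (p : ℝ) {a : ι} {T : Finset ι} (haT : a ∉ T) (V : Finset ι) :
    cmono p (insert a T) V = ((if a ∈ V then (1 : ℝ) else 0) - p) * cmono p T V := by
  unfold cmono; rw [prod_insert haT]

/-- **Splitting off the coordinate `a ∉ s` at a point `V ∌ a`**: `P_c^{(s+a)}(V) = A(V) − p·E(V)` with `A = P^{(s)}_c`,
`E = P^{(s)}_{c(·+a)}`. [cite: ODonnell2014, §9.1 (the decomposition g = a + χ·e)] -/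
theorem cpoly_insert_of_not_mem {s : Finset ι} {a : ι} (ha : a ∉ s) (p : ℝ) (c : Finset ι → ℝ) {V : Finset ι}
    (haV : a ∉ V) :
    cpoly (insert a s) p c V = cpoly s p c V + (-p) * cpoly s p (fun T => c (insert a T)) V := by
  unfold cpoly
  rw [sum_powerset_insert ha, mul_sum]
  congr 1
  refine sum_congr rfl fun T hT => ?_
  have haT : a ∉ T := fun h => ha (mem_powerset.1 hT h)
  rw [cmono_insert p haT, if_neg haV]
  ring

/-- **Splitting off the coordinate at the point `insert a V`**, `V ⊆ s`: `P_c^{(s+a)}(V+a) = A(V) + (1−p)·E(V)`.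
[cite: ODonnell2014, §9.1 (the decomposition g = a + χ·e)] -/
theorem cpoly_insert_insert {s : Finset ι} {a : ι} (ha : a ∉ s) (p : ℝ) (c : Finset ι → ℝ) (V : Finset ι) :
    cpoly (insert a s) p c (insert a V) = cpoly s p c V + (1 - p) * cpoly s p (fun T => c (insert a T)) V := by
  unfold cpoly
  rw [sum_powerset_insert ha, mul_sum]
  congr 1
  · refine sum_congr rfl fun T hT => ?_
    have haT : a ∉ T := fun h => ha (mem_powerset.1 hT h)
    rw [cmono_insert_of_not_mem p haT]
  · refine sum_congr rfl fun T hT => ?_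
    have haT : a ∉ T := fun h => ha (mem_powerset.1 hT h)
    rw [cmono_insert p haT, if_pos (mem_insert_self a V), cmono_insert_of_not_mem p haT]
    ring

/-- The second moment along one biased coordinate: `(1−p)(A − pE)² + p(A + (1−p)E)² = A² + p(1−p)E²` (the centred
`p`-biased bit has mean `0` and variance `p(1−p)`). [cite: ODonnell2014, §8.4 (mean and variance of a p-biased bit)] -/
theorem two_point_sq (p A E : ℝ) :
    (1 - p) * (A + (-p) * E) ^ 2 + p * (A + (1 - p) * E) ^ 2 = A ^ 2 + p * (1 - p) * E ^ 2 := by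
  ring

/-! ### §2 The biased two-point inequality (convex domination by the symmetric two-point law) -/

/-- Convexity of `t ↦ t^{2r}` between `A − u` and `A + u`: for `|x| ≤ u`, `u > 0`,
`(A + x)^{2r} ≤ ((u−x)/(2u))·(A−u)^{2r} + ((u+x)/(2u))·(A+u)^{2r}`. [folklore] -/
private theorem pow_le_convex_comb {A x u : ℝ} (hu : 0 < u) (hx : |x| ≤ u) (r : ℕ) :
    (A + x) ^ (2 * r) ≤ (u - x) / (2 * u) * (A - u) ^ (2 * r) + (u + x) / (2 * u) * (A + u) ^ (2 * r) := by
  have hconv := (Even.convexOn_pow (𝕜 := ℝ) (even_two_mul r)).2 (Set.mem_univ (A - u)) (Set.mem_univ (A + u))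
  have hxu := abs_le.1 hx
  have ha : 0 ≤ (u - x) / (2 * u) := div_nonneg (by linarith) (by linarith)
  have hb : 0 ≤ (u + x) / (2 * u) := div_nonneg (by linarith) (by linarith)
  have hab : (u - x) / (2 * u) + (u + x) / (2 * u) = 1 := by
    field_simp; ring
  have h := hconv ha hb hab
  simp only [smul_eq_mul] at h
  have hpt : (u - x) / (2 * u) * (A - u) + (u + x) / (2 * u) * (A + u) = A + x := by
    field_simp; ring
  rw [hpt] at h
  exact h

/-- **The biased two-point inequality.** For `0 ≤ p ≤ 1`, reals `A, E`, `r ∈ ℕ` and `u = max(p,1−p)·|E|`: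
`(1−p)·(A − pE)^{2r} + p·(A + (1−p)E)^{2r} ≤ ((A + u)^{2r} + (A − u)^{2r})/2` — the centred `p`-biased bit times `E` is
mean-zero and supported in `[−u, u]`, hence dominated in convex order by the uniform sign times `u`.
[cite: ODonnell2014, §10.3 (two-point hypercontractivity of biased bits; here for even moments via convex order)] -/
theorem biased_two_point_le {p : ℝ} (hp0 : 0 ≤ p) (hp1 : p ≤ 1) (A E : ℝ) (r : ℕ) :
    (1 - p) * (A + (-p) * E) ^ (2 * r) + p * (A + (1 - p) * E) ^ (2 * r) ≤
      ((A + max p (1 - p) * |E|) ^ (2 * r) + (A - max p (1 - p) * |E|) ^ (2 * r)) / 2 := by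
  set m : ℝ := max p (1 - p) with hm
  have hm0 : 0 < m := by
    rcases le_or_gt p (1 / 2) with hle | hgt
    · exact lt_of_lt_of_le (by linarith : (0 : ℝ) < 1 - p) (le_max_right _ _)
    · exact lt_of_lt_of_le (by linarith : (0 : ℝ) < p) (le_max_left _ _)
  by_cases hE : E = 0
  · subst hE
    simp only [mul_zero, add_zero, abs_zero, sub_zero]
    nlinarith [sq_nonneg A]
  set u : ℝ := m * |E| with hu_def
  have hEpos : 0 < |E| := abs_pos.2 hE
  have hu : 0 < u := mul_pos hm0 hEpos
  -- both atoms lie in `[−u, u]`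
  have hxf : |(-p) * E| ≤ u := by
    rw [abs_mul, abs_neg, abs_of_nonneg hp0]
    exact mul_le_mul_of_nonneg_right (le_max_left _ _) hEpos.le
  have hxt : |(1 - p) * E| ≤ u := by
    rw [abs_mul, abs_of_nonneg (by linarith : (0 : ℝ) ≤ 1 - p)]
    exact mul_le_mul_of_nonneg_right (le_max_right _ _) hEpos.le
  have hf := pow_le_convex_comb (A := A) hu hxf r
  have ht := pow_le_convex_comb (A := A) hu hxt r
  have h1p : 0 ≤ 1 - p := by linarith
  have hcomb := add_le_add (mul_le_mul_of_nonneg_left hf h1p) (mul_le_mul_of_nonneg_left ht hp0)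
  refine hcomb.trans (le_of_eq ?_)
  have hu0 : u ≠ 0 := hu.ne'
  field_simp
  ring

/-! ### §3 Weighted AM–GM for the mixed moments -/

/-- **Weighted AM–GM in place of Hölder** (weighted form of the tree's `avg_pow_mul_pow_le`): for nonnegative weights `w`,
if `Σ w·a^{2r} ≤ P^r` and `Σ w·e^{2r} ≤ Q^r`, then `Σ w·a^{2(r−i)} e^{2i} ≤ P^{r−i} Q^i` (`0 < i < r`; pointwise
`u^{1−θ}v^θ ≤ (1−θ)u + θv`, `θ = i/r`, `u = a^{2r}/P^r`, `v = e^{2r}/Q^r`, then the weighted sum).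
[cite: ODonnell2014, §9.1] -/
theorem wsum_pow_mul_pow_le {κ : Type*} (t : Finset κ) (w a e : κ → ℝ) (hw : ∀ y ∈ t, 0 ≤ w y)
    {r i : ℕ} (hi0 : 0 < i) (hir : i < r) {P Q : ℝ} (hP : 0 ≤ P) (hQ : 0 ≤ Q)
    (ha : ∑ y ∈ t, w y * (a y ^ 2) ^ r ≤ P ^ r) (he : ∑ y ∈ t, w y * (e y ^ 2) ^ r ≤ Q ^ r) :
    ∑ y ∈ t, w y * ((a y ^ 2) ^ (r - i) * (e y ^ 2) ^ i) ≤ P ^ (r - i) * Q ^ i := by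
  have hr0 : 0 < r := lt_of_le_of_lt (Nat.zero_le i) hir
  have hri0 : 0 < r - i := Nat.sub_pos_of_lt hir
  -- degenerate cases `P = 0` / `Q = 0`
  rcases hP.eq_or_lt with hP0 | hPpos
  · subst hP0
    rw [zero_pow hr0.ne'] at ha
    have hzero : ∀ y ∈ t, w y * (a y ^ 2) ^ r = 0 := fun y hy =>
      (sum_eq_zero_iff_of_nonneg fun y hy => mul_nonneg (hw y hy) (by positivity)).1
        (le_antisymm ha (sum_nonneg fun y hy => mul_nonneg (hw y hy) (by positivity))) y hy
    rw [zero_pow hri0.ne', zero_mul]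
    refine le_of_eq (sum_eq_zero fun y hy => ?_)
    rcases mul_eq_zero.1 (hzero y hy) with h | h
    · rw [h, zero_mul]
    · have : a y ^ 2 = 0 := (pow_eq_zero_iff hr0.ne').1 h
      rw [this, zero_pow hri0.ne', zero_mul, mul_zero]
  rcases hQ.eq_or_lt with hQ0 | hQpos
  · subst hQ0
    rw [zero_pow hr0.ne'] at he
    have hzero : ∀ y ∈ t, w y * (e y ^ 2) ^ r = 0 := fun y hy =>
      (sum_eq_zero_iff_of_nonneg fun y hy => mul_nonneg (hw y hy) (by positivity)).1
        (le_antisymm he (sum_nonneg fun y hy => mul_nonneg (hw y hy) (by positivity))) y hy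
    rw [zero_pow hi0.ne', mul_zero]
    refine le_of_eq (sum_eq_zero fun y hy => ?_)
    rcases mul_eq_zero.1 (hzero y hy) with h | h
    · rw [h, zero_mul]
    · have : e y ^ 2 = 0 := (pow_eq_zero_iff hr0.ne').1 h
      rw [this, zero_pow hi0.ne', mul_zero, mul_zero]
  -- main case: pointwise weighted AM–GM
  set w₁ : ℝ := ((r - i : ℕ) : ℝ) / r with hw₁
  set w₂ : ℝ := (i : ℝ) / r with hw₂
  have hrpos : (0 : ℝ) < r := by exact_mod_cast hr0
  have hw₁0 : 0 ≤ w₁ := by positivity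
  have hw₂0 : 0 ≤ w₂ := by positivity
  have hw12 : w₁ + w₂ = 1 := by
    rw [hw₁, hw₂, ← add_div, div_eq_one_iff_eq hrpos.ne', Nat.cast_sub hir.le]
    ring
  have hpt : ∀ y, (a y ^ 2) ^ (r - i) * (e y ^ 2) ^ i ≤
      P ^ (r - i) * Q ^ i * (w₁ * ((a y ^ 2) ^ r / P ^ r) + w₂ * ((e y ^ 2) ^ r / Q ^ r)) := by
    intro y
    set u : ℝ := a y ^ 2 / P with hu
    set v : ℝ := e y ^ 2 / Q with hv
    have hu0 : 0 ≤ u := by positivity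
    have hv0 : 0 ≤ v := by positivity
    have hamgm := Real.geom_mean_le_arith_mean2_weighted hw₁0 hw₂0 (pow_nonneg hu0 r) (pow_nonneg hv0 r) hw12
    have e1 : (u ^ r) ^ w₁ = u ^ (r - i) := by
      rw [← Real.rpow_natCast u r, ← Real.rpow_mul hu0, hw₁, mul_div_cancel₀ _ hrpos.ne', Real.rpow_natCast]
    have e2 : (v ^ r) ^ w₂ = v ^ i := by
      rw [← Real.rpow_natCast v r, ← Real.rpow_mul hv0, hw₂, mul_div_cancel₀ _ hrpos.ne', Real.rpow_natCast]
    rw [e1, e2] at hamgm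
    have eu : ∀ k : ℕ, u ^ k * P ^ k = (a y ^ 2) ^ k := fun k => by
      rw [hu, div_pow, div_mul_cancel₀ _ (pow_ne_zero k hPpos.ne')]
    have ev : ∀ k : ℕ, v ^ k * Q ^ k = (e y ^ 2) ^ k := fun k => by
      rw [hv, div_pow, div_mul_cancel₀ _ (pow_ne_zero k hQpos.ne')]
    have hur : (a y ^ 2) ^ r / P ^ r = u ^ r := by rw [hu, div_pow]
    have hvr : (e y ^ 2) ^ r / Q ^ r = v ^ r := by rw [hv, div_pow]
    rw [hur, hvr, ← eu (r - i), ← ev i]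
    calc u ^ (r - i) * P ^ (r - i) * (v ^ i * Q ^ i) = (P ^ (r - i) * Q ^ i) * (u ^ (r - i) * v ^ i) := by ring
      _ ≤ (P ^ (r - i) * Q ^ i) * (w₁ * u ^ r + w₂ * v ^ r) :=
          mul_le_mul_of_nonneg_left hamgm (by positivity)
  have hPr : 0 < P ^ r := pow_pos hPpos r
  have hQr : 0 < Q ^ r := pow_pos hQpos r
  have ha' : ∑ y ∈ t, w y * ((a y ^ 2) ^ r / P ^ r) ≤ 1 := by
    have : ∑ y ∈ t, w y * ((a y ^ 2) ^ r / P ^ r) = (∑ y ∈ t, w y * (a y ^ 2) ^ r) / P ^ r := by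
      rw [sum_div]; exact sum_congr rfl fun y _ => by ring
    rw [this, div_le_one hPr]; exact ha
  have he' : ∑ y ∈ t, w y * ((e y ^ 2) ^ r / Q ^ r) ≤ 1 := by
    have : ∑ y ∈ t, w y * ((e y ^ 2) ^ r / Q ^ r) = (∑ y ∈ t, w y * (e y ^ 2) ^ r) / Q ^ r := by
      rw [sum_div]; exact sum_congr rfl fun y _ => by ring
    rw [this, div_le_one hQr]; exact he
  calc ∑ y ∈ t, w y * ((a y ^ 2) ^ (r - i) * (e y ^ 2) ^ i)
      ≤ ∑ y ∈ t, w y * (P ^ (r - i) * Q ^ i * (w₁ * ((a y ^ 2) ^ r / P ^ r) + w₂ * ((e y ^ 2) ^ r / Q ^ r))) :=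
        sum_le_sum fun y hy => mul_le_mul_of_nonneg_left (hpt y) (hw y hy)
    _ = P ^ (r - i) * Q ^ i * (w₁ * ∑ y ∈ t, w y * ((a y ^ 2) ^ r / P ^ r) + w₂ * ∑ y ∈ t, w y * ((e y ^ 2) ^ r / Q ^ r)) := by
        rw [mul_sum, mul_sum, ← sum_add_distrib, mul_sum]
        exact sum_congr rfl fun y _ => by ring
    _ ≤ P ^ (r - i) * Q ^ i * (w₁ * 1 + w₂ * 1) := by
        refine mul_le_mul_of_nonneg_left ?_ (by positivity)
        exact add_le_add (mul_le_mul_of_nonneg_left ha' hw₁0) (mul_le_mul_of_nonneg_left he' hw₂0)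
    _ = P ^ (r - i) * Q ^ i := by rw [mul_one, mul_one, hw12, mul_one]

/-! ### §4 Bonami's lemma on the `p`-biased cube -/

/-- **Bonami's lemma (even moments) on the `p`-biased cube.** For `0 < p < 1`, `r ≥ 1`, a ground set `s` and a coefficient
vector `c` vanishing on the subsets of `s` of size `> d`:
`Σ_{V ⊆ s} w_s(V) P_c(V)^{2r} ≤ ((2r−1)·max(p,1−p)/min(p,1−p))^{rd} · (Σ_{V ⊆ s} w_s(V) P_c(V)²)^r`.
(Written with `(P²)^r`; `w_s` sums to `1`, so this reads `‖P_c‖_{2r} ≤ ((2r−1)(1−λ)/λ)^{d/2}‖P_c‖₂`, `λ = min(p,1−p)`.)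
[cite: ODonnell2014, Thm. 10.21 (hypercontractivity of the biased cube; even q)] -/
theorem biased_bonami_even_moment {p : ℝ} (hp0 : 0 < p) (hp1 : p < 1) (r : ℕ) (hr : 1 ≤ r) :
    ∀ (s : Finset ι) (d : ℕ) (c : Finset ι → ℝ), (∀ T, T ⊆ s → d < T.card → c T = 0) →
      ∑ V ∈ s.powerset, bweight s p V * (cpoly s p c V ^ 2) ^ r ≤
        ((2 * r - 1 : ℝ) * (max p (1 - p) / min p (1 - p))) ^ (r * d) *
          (∑ V ∈ s.powerset, bweight s p V * cpoly s p c V ^ 2) ^ r := by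
  -- the constant
  set K : ℝ := (2 * r - 1 : ℝ) * (max p (1 - p) / min p (1 - p)) with hK
  have h2r1 : (1 : ℝ) ≤ 2 * r - 1 := by
    have : (1 : ℝ) ≤ r := by exact_mod_cast hr
    linarith
  have hmin : 0 < min p (1 - p) := lt_min hp0 (by linarith)
  have hmaxmin : 1 ≤ max p (1 - p) / min p (1 - p) := by
    rw [le_div_iff₀ hmin, one_mul]; exact min_le_max
  have hK1 : 1 ≤ K := by
    rw [hK]; nlinarith
  have hK0 : 0 ≤ K := le_trans zero_le_one hK1
  -- `K · p(1−p) = (2r−1)·max(p,1−p)²` (because `p(1−p) = min·max`)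
  have hKp : K * (p * (1 - p)) = (2 * r - 1) * max p (1 - p) ^ 2 := by
    have hpm : p * (1 - p) = min p (1 - p) * max p (1 - p) := by
      rcases le_total p (1 - p) with h | h
      · rw [min_eq_left h, max_eq_right h]
      · rw [min_eq_right h, max_eq_left h, mul_comm]
    rw [hK, hpm]
    field_simp
  have hw0 : ∀ (s : Finset ι) (V : Finset ι), 0 ≤ bweight s p V := fun s V => bweight_nonneg s hp0.le hp1.le V
  intro s
  induction s using Finset.induction_on with
  | empty =>
    intro d c _
    rw [powerset_empty, sum_singleton, sum_singleton, bweight_empty, one_mul, one_mul]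
    exact le_mul_of_one_le_left (by positivity) (one_le_pow₀ hK1)
  | @insert a s ha ih =>
    intro d c hc
    -- the two parts
    set c' : Finset ι → ℝ := fun T => c (insert a T) with hc'
    set A : Finset ι → ℝ := fun V => cpoly s p c V with hA
    set E : Finset ι → ℝ := fun V => cpoly s p c' V with hE
    have hdegA : ∀ T, T ⊆ s → d < T.card → c T = 0 := fun T hT hd => hc T (hT.trans (subset_insert a s)) hd
    have hdegE : ∀ T, T ⊆ s → d - 1 < T.card → 1 ≤ d → c' T = 0 := by
      intro T hT hd h1
      have haT : a ∉ T := fun h => ha (hT h)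
      refine hc (insert a T) (insert_subset_insert a hT) ?_
      rw [card_insert_of_notMem haT]; omega
    -- splitting the sums over the points of the bigger cube
    have hnot : ∀ V ∈ s.powerset, a ∉ V := fun V hV haV => ha (mem_powerset.1 hV haV)
    have hsplit : ∀ F : Finset ι → ℝ, ∑ V ∈ (insert a s).powerset, bweight (insert a s) p V * F V =
        ∑ V ∈ s.powerset, bweight s p V * ((1 - p) * F V + p * F (insert a V)) := by
      intro F
      rw [sum_powerset_insert ha, ← sum_add_distrib]
      refine sum_congr rfl fun V hV => ?_
      rw [bweight_insert_of_not_mem ha p (hnot V hV), bweight_insert_insert ha p V]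
      ring
    have hvalV : ∀ V ∈ s.powerset, cpoly (insert a s) p c V = A V + (-p) * E V := fun V hV =>
      cpoly_insert_of_not_mem ha p c (hnot V hV)
    have hvalI : ∀ V ∈ s.powerset, cpoly (insert a s) p c (insert a V) = A V + (1 - p) * E V := fun V _ =>
      cpoly_insert_insert ha p c V
    -- second moment: `Σ w″ P² = Σ w (A² + p(1−p)E²)`
    have hsq : ∑ V ∈ (insert a s).powerset, bweight (insert a s) p V * cpoly (insert a s) p c V ^ 2 =
        ∑ V ∈ s.powerset, bweight s p V * A V ^ 2 + p * (1 - p) * ∑ V ∈ s.powerset, bweight s p V * E V ^ 2 := by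
      rw [hsplit, mul_sum, ← sum_add_distrib]
      refine sum_congr rfl fun V hV => ?_
      rw [hvalV V hV, hvalI V hV, two_point_sq]
      ring
    -- `2r`-th moment: the biased two-point inequality, then the uniform expansion
    set m : ℝ := max p (1 - p) with hm
    have hmom : ∑ V ∈ (insert a s).powerset, bweight (insert a s) p V * (cpoly (insert a s) p c V ^ 2) ^ r ≤
        ∑ i ∈ range (r + 1), ((2 * r).choose (2 * i) : ℝ) * (m ^ 2) ^ i *
          ∑ V ∈ s.powerset, bweight s p V * ((A V ^ 2) ^ (r - i) * (E V ^ 2) ^ i) := by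
      rw [hsplit]
      have key : ∀ V ∈ s.powerset, bweight s p V * ((1 - p) * (cpoly (insert a s) p c V ^ 2) ^ r +
          p * (cpoly (insert a s) p c (insert a V) ^ 2) ^ r) ≤
            bweight s p V * ∑ i ∈ range (r + 1), ((2 * r).choose (2 * i) : ℝ) * (m ^ 2) ^ i *
              ((A V ^ 2) ^ (r - i) * (E V ^ 2) ^ i) := by
        intro V hV
        refine mul_le_mul_of_nonneg_left ?_ (hw0 s V)
        rw [hvalV V hV, hvalI V hV, ← pow_mul, ← pow_mul]
        have h2 := biased_two_point_le hp0.le hp1.le (A V) (E V) r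
        rw [two_point_expand] at h2
        refine h2.trans (le_of_eq (sum_congr rfl fun i _ => ?_))
        rw [mul_pow, sq_abs, mul_pow]
        ring
      refine (sum_le_sum key).trans (le_of_eq ?_)
      simp_rw [mul_sum]
      rw [sum_comm]
      exact sum_congr rfl fun i _ => sum_congr rfl fun V _ => by ring
    -- the induction hypotheses
    set SA : ℝ := ∑ V ∈ s.powerset, bweight s p V * A V ^ 2 with hSA
    set SE : ℝ := ∑ V ∈ s.powerset, bweight s p V * E V ^ 2 with hSE
    set P : ℝ := K ^ d * SA with hP_def
    set Q : ℝ := K ^ (d - 1) * SE with hQ_def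
    have hSA0 : 0 ≤ SA := sum_nonneg fun V _ => mul_nonneg (hw0 s V) (sq_nonneg _)
    have hSE0 : 0 ≤ SE := sum_nonneg fun V _ => mul_nonneg (hw0 s V) (sq_nonneg _)
    have hP0 : 0 ≤ P := mul_nonneg (pow_nonneg hK0 _) hSA0
    have hQ0 : 0 ≤ Q := mul_nonneg (pow_nonneg hK0 _) hSE0
    have iha : ∑ V ∈ s.powerset, bweight s p V * (A V ^ 2) ^ r ≤ P ^ r := by
      have h := ih d c hdegA
      rw [hP_def, mul_pow, ← pow_mul, mul_comm d r]
      exact h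
    -- the mixed moments are at most `P^{r-i} Q^i`; in the case `d = 0` the odd part vanishes
    have hmixed : ∀ i ∈ range (r + 1),
        ((2 * r).choose (2 * i) : ℝ) * (m ^ 2) ^ i * ∑ V ∈ s.powerset, bweight s p V * ((A V ^ 2) ^ (r - i) * (E V ^ 2) ^ i) ≤
          ((2 * r).choose (2 * i) : ℝ) * P ^ (r - i) * (m ^ 2 * Q) ^ i := by
      intro i hi
      have hir : i ≤ r := Nat.lt_succ_iff.1 (mem_range.1 hi)
      suffices hS : ∑ V ∈ s.powerset, bweight s p V * ((A V ^ 2) ^ (r - i) * (E V ^ 2) ^ i) ≤ P ^ (r - i) * Q ^ i by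
        calc ((2 * r).choose (2 * i) : ℝ) * (m ^ 2) ^ i *
              ∑ V ∈ s.powerset, bweight s p V * ((A V ^ 2) ^ (r - i) * (E V ^ 2) ^ i)
            ≤ ((2 * r).choose (2 * i) : ℝ) * (m ^ 2) ^ i * (P ^ (r - i) * Q ^ i) :=
              mul_le_mul_of_nonneg_left hS (by positivity)
          _ = ((2 * r).choose (2 * i) : ℝ) * P ^ (r - i) * (m ^ 2 * Q) ^ i := by rw [mul_pow]; ring
      rcases Nat.eq_zero_or_pos i with rfl | hi0
      · simpa using iha
      -- for `i ≥ 1` we need the hypothesis on `E`, available when `d ≥ 1`; when `d = 0`, `E ≡ 0`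
      rcases Nat.eq_zero_or_pos d with hd0 | hdpos
      · have hE0 : ∀ V, E V = 0 := by
          intro V
          simp only [hE, cpoly]
          refine sum_eq_zero fun T hT => ?_
          have hT' : T ⊆ s := mem_powerset.1 hT
          have haT : a ∉ T := fun h => ha (hT' h)
          have : c' T = 0 := by
            refine hc (insert a T) (insert_subset_insert a hT') ?_
            rw [card_insert_of_notMem haT]; omega
          rw [this, zero_mul]
        have hl : ∑ V ∈ s.powerset, bweight s p V * ((A V ^ 2) ^ (r - i) * (E V ^ 2) ^ i) = 0 :=
          sum_eq_zero fun V _ => by rw [hE0 V]; simp [zero_pow hi0.ne']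
        rw [hl]
        positivity
      have ihe : ∑ V ∈ s.powerset, bweight s p V * (E V ^ 2) ^ r ≤ Q ^ r := by
        have h := ih (d - 1) c' (fun T hT hd => hdegE T hT hd hdpos)
        rw [hQ_def, mul_pow, ← pow_mul, mul_comm (d - 1) r]
        exact h
      rcases hir.lt_or_eq with hlt | rfl
      · exact wsum_pow_mul_pow_le _ _ _ _ (fun V _ => hw0 s V) hi0 hlt hP0 hQ0 iha ihe
      · simpa using ihe
    -- assemble
    have hm2Q : 0 ≤ m ^ 2 * Q := mul_nonneg (sq_nonneg _) hQ0
    have hfinal : ∑ V ∈ (insert a s).powerset, bweight (insert a s) p V * (cpoly (insert a s) p c V ^ 2) ^ r ≤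
        (P + (2 * r - 1) * (m ^ 2 * Q)) ^ r :=
      calc _ ≤ _ := hmom
        _ ≤ ∑ i ∈ range (r + 1), ((2 * r).choose (2 * i) : ℝ) * P ^ (r - i) * (m ^ 2 * Q) ^ i := sum_le_sum hmixed
        _ ≤ (P + (2 * r - 1) * (m ^ 2 * Q)) ^ r := sum_choose_two_mul_le r hP0 hm2Q
    -- compare with `K^d · (second moment)`
    have hcmp : P + (2 * r - 1) * (m ^ 2 * Q) ≤ K ^ d * (SA + p * (1 - p) * SE) := by
      suffices hX : (2 * r - 1) * (m ^ 2 * Q) ≤ K ^ d * (p * (1 - p) * SE) by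
        rw [mul_add, ← hP_def]; linarith
      rcases Nat.eq_zero_or_pos d with hd0 | hdpos
      · -- `d = 0`: `SE = 0`
        have hE0 : ∀ V ∈ s.powerset, E V = 0 := by
          intro V _
          simp only [hE, cpoly]
          refine sum_eq_zero fun T hT => ?_
          have hT' : T ⊆ s := mem_powerset.1 hT
          have haT : a ∉ T := fun h => ha (hT' h)
          have : c' T = 0 := by
            refine hc (insert a T) (insert_subset_insert a hT') ?_
            rw [card_insert_of_notMem haT]; omega
          rw [this, zero_mul]
        have hSE' : SE = 0 := sum_eq_zero fun V hV => by rw [hE0 V hV]; ring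
        rw [hQ_def, hSE']
        simp
      · obtain ⟨d', rfl⟩ := Nat.exists_eq_add_of_le hdpos
        rw [hQ_def, show 1 + d' - 1 = d' by omega, show 1 + d' = d' + 1 by omega, pow_succ K d']
        have : (2 * r - 1) * (m ^ 2 * (K ^ d' * SE)) = K ^ d' * ((2 * r - 1) * m ^ 2) * SE := by ring
        rw [this, ← hKp]
        refine le_of_eq ?_
        ring
    have hS0 : 0 ≤ P + (2 * r - 1) * (m ^ 2 * Q) := by nlinarith
    calc ∑ V ∈ (insert a s).powerset, bweight (insert a s) p V * (cpoly (insert a s) p c V ^ 2) ^ r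
        ≤ (P + (2 * r - 1) * (m ^ 2 * Q)) ^ r := hfinal
      _ ≤ (K ^ d * (SA + p * (1 - p) * SE)) ^ r := pow_le_pow_left₀ hS0 hcmp r
      _ = K ^ (r * d) * (∑ V ∈ (insert a s).powerset, bweight (insert a s) p V * cpoly (insert a s) p c V ^ 2) ^ r := by
          rw [hsq, mul_pow, ← pow_mul, mul_comm d r]

/-! ### §5 The whole cube `{V ⊆ [n]}` -/

/-- On the full ground set `Fin n`, `w(V) = p^{|V|}(1−p)^{n−|V|}`. [cite: ODonnell2014, §8.4 (π_p^{⊗n})] -/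
theorem bweight_univ_eq (p : ℝ) {n : ℕ} (V : Finset (Fin n)) :
    bweight (univ : Finset (Fin n)) p V = p ^ V.card * (1 - p) ^ (n - V.card) := by
  unfold bweight
  rw [prod_ite, prod_const, prod_const]
  have h1 : (univ.filter fun i : Fin n => i ∈ V) = V := by ext i; simp
  have h2 : (univ.filter fun i : Fin n => ¬ i ∈ V) = univ \ V := by ext i; simp
  rw [h1, h2, card_univ_sdiff, Fintype.card_fin]

/-- **Bonami's lemma on the `p`-biased cube `{0,1}^n`** (points = all subsets `V ⊆ [n]`): for `0 < p < 1`, `r ≥ 1` and `c`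
vanishing on sets of size `> d`,
`Σ_V p^{|V|}(1−p)^{n−|V|} P_c(V)^{2r} ≤ ((2r−1)·max(p,1−p)/min(p,1−p))^{rd} · (Σ_V p^{|V|}(1−p)^{n−|V|} P_c(V)²)^r`,
`P_c(V) = Σ_T c_T Π_{i∈T} (𝟙[i∈V] − p)`. [cite: ODonnell2014, Thm. 10.21 (even q)] -/
theorem biased_bonami_even_moment_univ {n : ℕ} {p : ℝ} (hp0 : 0 < p) (hp1 : p < 1) (r : ℕ) (hr : 1 ≤ r) (d : ℕ)
    (c : Finset (Fin n) → ℝ) (hc : ∀ T, d < T.card → c T = 0) :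
    ∑ V : Finset (Fin n), p ^ V.card * (1 - p) ^ (n - V.card) *
        ((∑ T : Finset (Fin n), c T * cmono p T V) ^ 2) ^ r ≤
      ((2 * r - 1 : ℝ) * (max p (1 - p) / min p (1 - p))) ^ (r * d) *
        (∑ V : Finset (Fin n), p ^ V.card * (1 - p) ^ (n - V.card) * (∑ T : Finset (Fin n), c T * cmono p T V) ^ 2) ^ r := by
  have h := biased_bonami_even_moment hp0 hp1 r hr (univ : Finset (Fin n)) d c (fun T _ hT => hc T hT)
  simp only [powerset_univ, cpoly, bweight_univ_eq] at h
  exact h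

/-! ### §6 Coordinate-dependent biases: the product of different biased bits

O'Donnell's Thm. 10.21 is stated for general product probability spaces; the special case needed by two-slice transfer
arguments (cell pnp-psdrank, LIT-29 §6 road (T2)) is a product of biased bits with DIFFERENT biases `p_i`. The induction of §4
goes through verbatim with the bias of the split coordinate in place of `p`, the constant becoming
`K = (2r−1)·κ` for any common bound `κ ≥ max(p_i,1−p_i)/min(p_i,1−p_i)` (`κ ≥ 1`). -/

/-- The product weight with coordinate biases `p : ι → ℝ`: `Π_{i∈s} (p_i if i ∈ V, 1−p_i otherwise)`.
[cite: ODonnell2014, §8.4 + Def. 8.40 (general product spaces)] -/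
def bweightv (s : Finset ι) (p : ι → ℝ) (V : Finset ι) : ℝ := ∏ i ∈ s, (if i ∈ V then p i else 1 - p i)

/-- The centred monomial with coordinate biases: `φ_T(V) = Π_{i∈T} (𝟙[i∈V] − p_i)`. [cite: ODonnell2014, §8.4] -/
def cmonov (p : ι → ℝ) (T V : Finset ι) : ℝ := ∏ i ∈ T, ((if i ∈ V then (1 : ℝ) else 0) - p i)

/-- The polynomial with coefficient vector `c` in the centred monomials with coordinate biases. [cite: ODonnell2014, §8.4] -/
def cpolyv (s : Finset ι) (p : ι → ℝ) (c : Finset ι → ℝ) (V : Finset ι) : ℝ := ∑ T ∈ s.powerset, c T * cmonov p T V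

/-- `w_∅ ≡ 1`. [cite: ODonnell2014, §8.4] -/
theorem bweightv_empty (p : ι → ℝ) (V : Finset ι) : bweightv ∅ p V = 1 := by
  unfold bweightv; rw [prod_empty]

/-- Adding a coordinate `a ∉ s`, point `V ∌ a`: factor `1 − p_a`. [cite: ODonnell2014, §8.4] -/
theorem bweightv_insert_of_not_mem {s : Finset ι} {a : ι} (ha : a ∉ s) (p : ι → ℝ) {V : Finset ι} (haV : a ∉ V) :
    bweightv (insert a s) p V = (1 - p a) * bweightv s p V := by
  unfold bweightv; rw [prod_insert ha, if_neg haV]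

/-- Adding a coordinate `a ∉ s`, point `insert a V`: factor `p_a`. [cite: ODonnell2014, §8.4] -/
theorem bweightv_insert_insert {s : Finset ι} {a : ι} (ha : a ∉ s) (p : ι → ℝ) (V : Finset ι) :
    bweightv (insert a s) p (insert a V) = p a * bweightv s p V := by
  unfold bweightv
  rw [prod_insert ha, if_pos (mem_insert_self a V)]
  congr 1
  refine prod_congr rfl fun i hi => ?_
  have hia : i ≠ a := fun h => ha (h ▸ hi)
  simp [mem_insert, hia]

/-- Nonnegativity for biases in `[0,1]` on `s`. [cite: ODonnell2014, §8.4] -/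
theorem bweightv_nonneg {s : Finset ι} {p : ι → ℝ} (hp : ∀ i ∈ s, 0 ≤ p i ∧ p i ≤ 1) (V : Finset ι) :
    0 ≤ bweightv s p V := by
  unfold bweightv
  refine prod_nonneg fun i hi => ?_
  have := hp i hi
  split_ifs
  · exact this.1
  · linarith [this.2]

/-- The weights of the points `V ⊆ s` sum to `1`. [cite: ODonnell2014, §8.4] -/
theorem sum_bweightv (s : Finset ι) (p : ι → ℝ) : ∑ V ∈ s.powerset, bweightv s p V = 1 := by
  induction s using Finset.induction_on with
  | empty => rw [powerset_empty, sum_singleton, bweightv_empty]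
  | @insert a s ha ih =>
    rw [sum_powerset_insert ha]
    have h1 : ∑ V ∈ s.powerset, bweightv (insert a s) p V = (1 - p a) * ∑ V ∈ s.powerset, bweightv s p V := by
      rw [mul_sum]
      refine sum_congr rfl fun V hV => bweightv_insert_of_not_mem ha p ?_
      exact fun haV => ha (mem_powerset.1 hV haV)
    have h2 : ∑ V ∈ s.powerset, bweightv (insert a s) p (insert a V) = p a * ∑ V ∈ s.powerset, bweightv s p V := by
      rw [mul_sum]
      exact sum_congr rfl fun V _ => bweightv_insert_insert ha p V
    rw [h1, h2, ih]; ring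

/-- `φ_T(insert a V) = φ_T(V)` for `a ∉ T`. [cite: ODonnell2014, §8.4] -/
theorem cmonov_insert_of_not_mem (p : ι → ℝ) {a : ι} {T : Finset ι} (haT : a ∉ T) (V : Finset ι) :
    cmonov p T (insert a V) = cmonov p T V := by
  unfold cmonov
  refine prod_congr rfl fun i hi => ?_
  have hia : i ≠ a := fun h => haT (h ▸ hi)
  simp [mem_insert, hia]

/-- `φ_{T+a}(V) = (𝟙[a∈V] − p_a)·φ_T(V)` for `a ∉ T`. [cite: ODonnell2014, §8.4] -/
theorem cmonov_insert (p : ι → ℝ) {a : ι} {T : Finset ι} (haT : a ∉ T) (V : Finset ι) :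
    cmonov p (insert a T) V = ((if a ∈ V then (1 : ℝ) else 0) - p a) * cmonov p T V := by
  unfold cmonov; rw [prod_insert haT]

/-- Splitting off `a ∉ s` at `V ∌ a`: `P^{(s+a)}_c(V) = A(V) − p_a·E(V)`. [cite: ODonnell2014, §9.1] -/
theorem cpolyv_insert_of_not_mem {s : Finset ι} {a : ι} (ha : a ∉ s) (p : ι → ℝ) (c : Finset ι → ℝ) {V : Finset ι}
    (haV : a ∉ V) :
    cpolyv (insert a s) p c V = cpolyv s p c V + (-p a) * cpolyv s p (fun T => c (insert a T)) V := by
  unfold cpolyv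
  rw [sum_powerset_insert ha, mul_sum]
  congr 1
  refine sum_congr rfl fun T hT => ?_
  have haT : a ∉ T := fun h => ha (mem_powerset.1 hT h)
  rw [cmonov_insert p haT, if_neg haV]
  ring

/-- Splitting off `a ∉ s` at `insert a V`: `P^{(s+a)}_c(V+a) = A(V) + (1−p_a)·E(V)`. [cite: ODonnell2014, §9.1] -/
theorem cpolyv_insert_insert {s : Finset ι} {a : ι} (ha : a ∉ s) (p : ι → ℝ) (c : Finset ι → ℝ) (V : Finset ι) :
    cpolyv (insert a s) p c (insert a V) = cpolyv s p c V + (1 - p a) * cpolyv s p (fun T => c (insert a T)) V := by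
  unfold cpolyv
  rw [sum_powerset_insert ha, mul_sum]
  congr 1
  · refine sum_congr rfl fun T hT => ?_
    have haT : a ∉ T := fun h => ha (mem_powerset.1 hT h)
    rw [cmonov_insert_of_not_mem p haT]
  · refine sum_congr rfl fun T hT => ?_
    have haT : a ∉ T := fun h => ha (mem_powerset.1 hT h)
    rw [cmonov_insert p haT, if_pos (mem_insert_self a V), cmonov_insert_of_not_mem p haT]
    ring

/-- **Bonami's lemma (even moments) on a product of differently biased bits.** For biases `p_i ∈ (0,1)` on `s` with
`max(p_i,1−p_i)/min(p_i,1−p_i) ≤ κ` (`κ ≥ 1`), `r ≥ 1`, and a coefficient vector `c` vanishing on subsets of `s` of size `> d`: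
`Σ_{V⊆s} w_s(V) P_c(V)^{2r} ≤ ((2r−1)κ)^{rd} · (Σ_{V⊆s} w_s(V) P_c(V)²)^r`.
[cite: ODonnell2014, Thm. 10.21 (hypercontractivity of general product spaces; even q, the product of biased bits)] -/
theorem biased_bonami_even_moment_vec {p : ι → ℝ} {κ : ℝ} (hκ1 : 1 ≤ κ) (r : ℕ) (hr : 1 ≤ r) :
    ∀ (s : Finset ι), (∀ i ∈ s, 0 < p i ∧ p i < 1 ∧ max (p i) (1 - p i) / min (p i) (1 - p i) ≤ κ) →
      ∀ (d : ℕ) (c : Finset ι → ℝ), (∀ T, T ⊆ s → d < T.card → c T = 0) →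
      ∑ V ∈ s.powerset, bweightv s p V * (cpolyv s p c V ^ 2) ^ r ≤
        ((2 * r - 1 : ℝ) * κ) ^ (r * d) * (∑ V ∈ s.powerset, bweightv s p V * cpolyv s p c V ^ 2) ^ r := by
  -- the constant
  set K : ℝ := (2 * r - 1 : ℝ) * κ with hK
  have h2r1 : (1 : ℝ) ≤ 2 * r - 1 := by
    have : (1 : ℝ) ≤ r := by exact_mod_cast hr
    linarith
  have hK1 : 1 ≤ K := by rw [hK]; nlinarith
  have hK0 : 0 ≤ K := le_trans zero_le_one hK1
  intro s
  induction s using Finset.induction_on with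
  | empty =>
    intro _ d c _
    rw [powerset_empty, sum_singleton, sum_singleton, bweightv_empty, one_mul, one_mul]
    exact le_mul_of_one_le_left (by positivity) (one_le_pow₀ hK1)
  | @insert a s ha ih =>
    intro hps d c hc
    have hps' : ∀ i ∈ s, 0 < p i ∧ p i < 1 ∧ max (p i) (1 - p i) / min (p i) (1 - p i) ≤ κ :=
      fun i hi => hps i (mem_insert_of_mem hi)
    obtain ⟨hpa0, hpa1, hpaκ⟩ := hps a (mem_insert_self a s)
    have hw0 : ∀ V : Finset ι, 0 ≤ bweightv s p V :=
      fun V => bweightv_nonneg (fun i hi => ⟨(hps' i hi).1.le, (hps' i hi).2.1.le⟩) V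
    -- `(2r−1)·max(p_a,1−p_a)² ≤ K · p_a(1−p_a)` (because `p_a(1−p_a) = min·max` and `max ≤ κ·min`)
    have hKp : (2 * r - 1) * max (p a) (1 - p a) ^ 2 ≤ K * (p a * (1 - p a)) := by
      have hmin : 0 < min (p a) (1 - p a) := lt_min hpa0 (by linarith)
      have hpm : p a * (1 - p a) = min (p a) (1 - p a) * max (p a) (1 - p a) := by
        rcases le_total (p a) (1 - p a) with h | h
        · rw [min_eq_left h, max_eq_right h]
        · rw [min_eq_right h, max_eq_left h, mul_comm]
      have hmk : max (p a) (1 - p a) ≤ κ * min (p a) (1 - p a) := by rwa [div_le_iff₀ hmin] at hpaκ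
      have hmax0 : 0 ≤ max (p a) (1 - p a) := hpa0.le.trans (le_max_left _ _)
      rw [hpm, hK, sq]
      have h0 : 0 ≤ (2 * r - 1 : ℝ) := le_trans zero_le_one h2r1
      calc (2 * r - 1 : ℝ) * (max (p a) (1 - p a) * max (p a) (1 - p a))
          ≤ (2 * r - 1 : ℝ) * (κ * min (p a) (1 - p a) * max (p a) (1 - p a)) :=
            mul_le_mul_of_nonneg_left (mul_le_mul_of_nonneg_right hmk hmax0) h0
        _ = (2 * r - 1 : ℝ) * κ * (min (p a) (1 - p a) * max (p a) (1 - p a)) := by ring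
    -- the two parts
    set c' : Finset ι → ℝ := fun T => c (insert a T) with hc'
    set A : Finset ι → ℝ := fun V => cpolyv s p c V with hA
    set E : Finset ι → ℝ := fun V => cpolyv s p c' V with hE
    have hdegA : ∀ T, T ⊆ s → d < T.card → c T = 0 := fun T hT hd => hc T (hT.trans (subset_insert a s)) hd
    have hdegE : ∀ T, T ⊆ s → d - 1 < T.card → 1 ≤ d → c' T = 0 := by
      intro T hT hd h1
      have haT : a ∉ T := fun h => ha (hT h)
      refine hc (insert a T) (insert_subset_insert a hT) ?_
      rw [card_insert_of_notMem haT]; omega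
    -- splitting the sums over the points of the bigger cube
    have hnot : ∀ V ∈ s.powerset, a ∉ V := fun V hV haV => ha (mem_powerset.1 hV haV)
    have hsplit : ∀ F : Finset ι → ℝ, ∑ V ∈ (insert a s).powerset, bweightv (insert a s) p V * F V =
        ∑ V ∈ s.powerset, bweightv s p V * ((1 - p a) * F V + p a * F (insert a V)) := by
      intro F
      rw [sum_powerset_insert ha, ← sum_add_distrib]
      refine sum_congr rfl fun V hV => ?_
      rw [bweightv_insert_of_not_mem ha p (hnot V hV), bweightv_insert_insert ha p V]
      ring
    have hvalV : ∀ V ∈ s.powerset, cpolyv (insert a s) p c V = A V + (-p a) * E V := fun V hV =>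
      cpolyv_insert_of_not_mem ha p c (hnot V hV)
    have hvalI : ∀ V ∈ s.powerset, cpolyv (insert a s) p c (insert a V) = A V + (1 - p a) * E V := fun V _ =>
      cpolyv_insert_insert ha p c V
    -- second moment
    have hsq : ∑ V ∈ (insert a s).powerset, bweightv (insert a s) p V * cpolyv (insert a s) p c V ^ 2 =
        ∑ V ∈ s.powerset, bweightv s p V * A V ^ 2 + p a * (1 - p a) * ∑ V ∈ s.powerset, bweightv s p V * E V ^ 2 := by
      rw [hsplit, mul_sum, ← sum_add_distrib]
      refine sum_congr rfl fun V hV => ?_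
      rw [hvalV V hV, hvalI V hV, two_point_sq]
      ring
    -- `2r`-th moment: the biased two-point inequality at bias `p_a`, then the uniform expansion
    set m : ℝ := max (p a) (1 - p a) with hm
    have hmom : ∑ V ∈ (insert a s).powerset, bweightv (insert a s) p V * (cpolyv (insert a s) p c V ^ 2) ^ r ≤
        ∑ i ∈ range (r + 1), ((2 * r).choose (2 * i) : ℝ) * (m ^ 2) ^ i *
          ∑ V ∈ s.powerset, bweightv s p V * ((A V ^ 2) ^ (r - i) * (E V ^ 2) ^ i) := by
      rw [hsplit]
      have key : ∀ V ∈ s.powerset, bweightv s p V * ((1 - p a) * (cpolyv (insert a s) p c V ^ 2) ^ r +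
          p a * (cpolyv (insert a s) p c (insert a V) ^ 2) ^ r) ≤
            bweightv s p V * ∑ i ∈ range (r + 1), ((2 * r).choose (2 * i) : ℝ) * (m ^ 2) ^ i *
              ((A V ^ 2) ^ (r - i) * (E V ^ 2) ^ i) := by
        intro V hV
        refine mul_le_mul_of_nonneg_left ?_ (hw0 V)
        rw [hvalV V hV, hvalI V hV, ← pow_mul, ← pow_mul]
        have h2 := biased_two_point_le hpa0.le hpa1.le (A V) (E V) r
        rw [two_point_expand] at h2
        refine h2.trans (le_of_eq (sum_congr rfl fun i _ => ?_))
        rw [mul_pow, sq_abs, mul_pow]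
        ring
      refine (sum_le_sum key).trans (le_of_eq ?_)
      simp_rw [mul_sum]
      rw [sum_comm]
      exact sum_congr rfl fun i _ => sum_congr rfl fun V _ => by ring
    -- the induction hypotheses
    set SA : ℝ := ∑ V ∈ s.powerset, bweightv s p V * A V ^ 2 with hSA
    set SE : ℝ := ∑ V ∈ s.powerset, bweightv s p V * E V ^ 2 with hSE
    set P : ℝ := K ^ d * SA with hP_def
    set Q : ℝ := K ^ (d - 1) * SE with hQ_def
    have hSA0 : 0 ≤ SA := sum_nonneg fun V _ => mul_nonneg (hw0 V) (sq_nonneg _)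
    have hSE0 : 0 ≤ SE := sum_nonneg fun V _ => mul_nonneg (hw0 V) (sq_nonneg _)
    have hP0 : 0 ≤ P := mul_nonneg (pow_nonneg hK0 _) hSA0
    have hQ0 : 0 ≤ Q := mul_nonneg (pow_nonneg hK0 _) hSE0
    have iha : ∑ V ∈ s.powerset, bweightv s p V * (A V ^ 2) ^ r ≤ P ^ r := by
      have h := ih hps' d c hdegA
      rw [hP_def, mul_pow, ← pow_mul, mul_comm d r]
      exact h
    have hE0_of_d0 : d = 0 → ∀ V, E V = 0 := by
      intro hd0 V
      simp only [hE, cpolyv]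
      refine sum_eq_zero fun T hT => ?_
      have hT' : T ⊆ s := mem_powerset.1 hT
      have haT : a ∉ T := fun h => ha (hT' h)
      have : c' T = 0 := by
        refine hc (insert a T) (insert_subset_insert a hT') ?_
        rw [card_insert_of_notMem haT]; omega
      rw [this, zero_mul]
    have hmixed : ∀ i ∈ range (r + 1),
        ((2 * r).choose (2 * i) : ℝ) * (m ^ 2) ^ i * ∑ V ∈ s.powerset, bweightv s p V * ((A V ^ 2) ^ (r - i) * (E V ^ 2) ^ i) ≤
          ((2 * r).choose (2 * i) : ℝ) * P ^ (r - i) * (m ^ 2 * Q) ^ i := by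
      intro i hi
      have hir : i ≤ r := Nat.lt_succ_iff.1 (mem_range.1 hi)
      suffices hS : ∑ V ∈ s.powerset, bweightv s p V * ((A V ^ 2) ^ (r - i) * (E V ^ 2) ^ i) ≤ P ^ (r - i) * Q ^ i by
        calc ((2 * r).choose (2 * i) : ℝ) * (m ^ 2) ^ i *
              ∑ V ∈ s.powerset, bweightv s p V * ((A V ^ 2) ^ (r - i) * (E V ^ 2) ^ i)
            ≤ ((2 * r).choose (2 * i) : ℝ) * (m ^ 2) ^ i * (P ^ (r - i) * Q ^ i) :=
              mul_le_mul_of_nonneg_left hS (by positivity)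
          _ = ((2 * r).choose (2 * i) : ℝ) * P ^ (r - i) * (m ^ 2 * Q) ^ i := by rw [mul_pow]; ring
      rcases Nat.eq_zero_or_pos i with rfl | hi0
      · simpa using iha
      rcases Nat.eq_zero_or_pos d with hd0 | hdpos
      · have hE0 := hE0_of_d0 hd0
        have hl : ∑ V ∈ s.powerset, bweightv s p V * ((A V ^ 2) ^ (r - i) * (E V ^ 2) ^ i) = 0 :=
          sum_eq_zero fun V _ => by rw [hE0 V]; simp [zero_pow hi0.ne']
        rw [hl]
        positivity
      have ihe : ∑ V ∈ s.powerset, bweightv s p V * (E V ^ 2) ^ r ≤ Q ^ r := by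
        have h := ih hps' (d - 1) c' (fun T hT hd => hdegE T hT hd hdpos)
        rw [hQ_def, mul_pow, ← pow_mul, mul_comm (d - 1) r]
        exact h
      rcases hir.lt_or_eq with hlt | rfl
      · exact wsum_pow_mul_pow_le _ _ _ _ (fun V _ => hw0 V) hi0 hlt hP0 hQ0 iha ihe
      · simpa using ihe
    -- assemble
    have hm2Q : 0 ≤ m ^ 2 * Q := mul_nonneg (sq_nonneg _) hQ0
    have hfinal : ∑ V ∈ (insert a s).powerset, bweightv (insert a s) p V * (cpolyv (insert a s) p c V ^ 2) ^ r ≤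
        (P + (2 * r - 1) * (m ^ 2 * Q)) ^ r :=
      calc _ ≤ _ := hmom
        _ ≤ ∑ i ∈ range (r + 1), ((2 * r).choose (2 * i) : ℝ) * P ^ (r - i) * (m ^ 2 * Q) ^ i := sum_le_sum hmixed
        _ ≤ (P + (2 * r - 1) * (m ^ 2 * Q)) ^ r := sum_choose_two_mul_le r hP0 hm2Q
    -- compare with `K^d · (second moment)`
    have hcmp : P + (2 * r - 1) * (m ^ 2 * Q) ≤ K ^ d * (SA + p a * (1 - p a) * SE) := by
      suffices hX : (2 * r - 1) * (m ^ 2 * Q) ≤ K ^ d * (p a * (1 - p a) * SE) by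
        rw [mul_add, ← hP_def]; linarith
      rcases Nat.eq_zero_or_pos d with hd0 | hdpos
      · have hE0 := hE0_of_d0 hd0
        have hSE' : SE = 0 := sum_eq_zero fun V _ => by rw [hE0 V]; ring
        rw [hQ_def, hSE']
        simp
      · obtain ⟨d', rfl⟩ := Nat.exists_eq_add_of_le hdpos
        rw [hQ_def, show 1 + d' - 1 = d' by omega, show 1 + d' = d' + 1 by omega, pow_succ K d']
        have hKd : 0 ≤ K ^ d' := pow_nonneg hK0 _
        calc (2 * r - 1) * (m ^ 2 * (K ^ d' * SE)) = K ^ d' * SE * ((2 * r - 1) * m ^ 2) := by ring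
          _ ≤ K ^ d' * SE * (K * (p a * (1 - p a))) :=
              mul_le_mul_of_nonneg_left hKp (mul_nonneg hKd hSE0)
          _ = K ^ d' * K * (p a * (1 - p a) * SE) := by ring
    have hS0 : 0 ≤ P + (2 * r - 1) * (m ^ 2 * Q) := by nlinarith
    calc ∑ V ∈ (insert a s).powerset, bweightv (insert a s) p V * (cpolyv (insert a s) p c V ^ 2) ^ r
        ≤ (P + (2 * r - 1) * (m ^ 2 * Q)) ^ r := hfinal
      _ ≤ (K ^ d * (SA + p a * (1 - p a) * SE)) ^ r := pow_le_pow_left₀ hS0 hcmp r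
      _ = K ^ (r * d) * (∑ V ∈ (insert a s).powerset, bweightv (insert a s) p V * cpolyv (insert a s) p c V ^ 2) ^ r := by
          rw [hsq, mul_pow, ← pow_mul, mul_comm d r]

/-- The constant-bias weights/polynomials are the vector ones at `p ≡ p`. [cite: ODonnell2014, §8.4] -/
theorem bweightv_const (s : Finset ι) (p : ℝ) (V : Finset ι) : bweightv s (fun _ => p) V = bweight s p V := rfl

/-- Same for the polynomials. [cite: ODonnell2014, §8.4] -/
theorem cpolyv_const (s : Finset ι) (p : ℝ) (c : Finset ι → ℝ) (V : Finset ι) :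
    cpolyv s (fun _ => p) c V = cpoly s p c V := rfl

end Literature.Combinatorics.AssociationSchemes.BiasedBonami
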